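import Mathlib.MeasureTheory.Integral.Bochner.Basic
import Mathlib.MeasureTheory.Integral.Bochner.L1
import Mathlib.MeasureTheory.Integral.Bochner.VitaliCaratheodory
import Mathlib.Probability.Notation

/-!
# The MULTIPLICATIVE abstract endgame of ratio mixing (toward `stub_RatioMix`, crux stmt-CriticalPhenomena-5076)

Support file (`--supports stmt-CriticalPhenomena-5076`, lead c2; registered sub-goal `abs_integral_sub_mul_le_mul`).
The density-form analogue of `abs_integral_sub_mul_le` (`…IKLinearTransportScreening.lean` §5.2): on a probability space,
if pointwise `|I − e g| ≤ s · e g` (screening in ratio form) and `g ≥ 0` is MULTIPLICATIVELY rigid, `g y ≤ (1 + t) g x` for all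
`x, y` (offsets in ratio form), with `e ≥ 0`, then `|∫ I − (∫ e)(∫ g)| ≤ (s (1 + t) + t) · (∫ e)(∫ g)`.
-/

noncomputable section

namespace Summit.CriticalPhenomena.CardyFormulaZ2.Theorems.IKLinearTransport.PinnedDiagramExchange.ScreeningAssembly

open MeasureTheory

/-- A multiplicatively rigid nonnegative function is within the factor `1 + t` of its mean, both ways. [folklore] -/
theorem mul_rigid_integral_bounds {α : Type*} [MeasurableSpace α] (μ : Measure α) [IsProbabilityMeasure μ]
    (g : α → ℝ) (hg : Integrable g μ) (t : ℝ) (ht : 0 ≤ t) (hrig : ∀ x y, g y ≤ (1 + t) * g x) (x : α) :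
    g x ≤ (1 + t) * ∫ y, g y ∂μ ∧ ∫ y, g y ∂μ ≤ (1 + t) * g x := by
  have _ := ht
  constructor
  · have h1 : ∫ _y, g x ∂μ ≤ ∫ y, (1 + t) * g y ∂μ :=
      integral_mono (integrable_const _) (hg.const_mul _) fun y => hrig y x
    rw [integral_const, probReal_univ, one_smul, integral_const_mul] at h1
    exact h1
  · have h1 : ∫ y, g y ∂μ ≤ ∫ _y, (1 + t) * g x ∂μ :=
      integral_mono hg (integrable_const _) fun y => hrig x y
    rw [integral_const, probReal_univ, one_smul] at h1
    exact h1

/-- THE MULTIPLICATIVE ABSTRACT ENDGAME (registered sub-goal `abs_integral_sub_mul_le_mul`): pointwise ratio screening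
`|I − e g| ≤ s e g`, multiplicative rigidity `g y ≤ (1+t) g x`, `e, g ≥ 0` give
`|∫ I − (∫ e)(∫ g)| ≤ (s (1 + t) + t) (∫ e)(∫ g)`. [folklore] -/
theorem abs_integral_sub_mul_le_mul : ∀ {α : Type*} [MeasurableSpace α] (μ : Measure α) [IsProbabilityMeasure μ]
    (I e g : α → ℝ), Integrable I μ → Integrable e μ → Integrable g μ → ∀ (s t : ℝ), 0 ≤ s → 0 ≤ t →
    (∀ x, 0 ≤ e x) → (∀ x, 0 ≤ g x) → (∀ x, |I x - e x * g x| ≤ s * (e x * g x)) → (∀ x y, g y ≤ (1 + t) * g x) →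
    |(∫ x, I x ∂μ) - (∫ x, e x ∂μ) * ∫ x, g x ∂μ| ≤ (s * (1 + t) + t) * ((∫ x, e x ∂μ) * ∫ x, g x ∂μ) := by
  intro α _ μ _ I e g hI he hg s t hs ht he0 hg0 hscr hrig
  set γ := ∫ y, g y ∂μ with hγ
  have hγ0 : 0 ≤ γ := integral_nonneg hg0
  have hE0 : 0 ≤ ∫ x, e x ∂μ := integral_nonneg he0
  have hbd := mul_rigid_integral_bounds μ g hg t ht hrig
  -- the integrand `e g` is integrable: `g` is bounded by `(1+t) γ`
  have heg : Integrable (fun x => e x * g x) μ := by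
    refine Integrable.mono' (he.const_mul ((1 + t) * γ)) (he.aestronglyMeasurable.mul hg.aestronglyMeasurable)
      (ae_of_all _ fun x => ?_)
    rw [Real.norm_eq_abs, abs_mul, abs_of_nonneg (he0 x), abs_of_nonneg (hg0 x), mul_comm ((1 + t) * γ)]
    exact mul_le_mul_of_nonneg_left (hbd x).1 (he0 x)
  -- (1) screening: `|∫ I − ∫ e g| ≤ s ∫ e g`
  have h1 : |(∫ x, I x ∂μ) - ∫ x, e x * g x ∂μ| ≤ s * ∫ x, e x * g x ∂μ := by
    rw [← integral_sub hI heg, ← integral_const_mul]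
    refine (abs_integral_le_integral_abs).trans ?_
    exact integral_mono_of_nonneg (ae_of_all _ fun x => abs_nonneg _) (heg.const_mul _) (ae_of_all _ hscr)
  -- (2) `∫ e g ≤ (1+t) γ ∫ e`
  have h2 : ∫ x, e x * g x ∂μ ≤ (1 + t) * γ * ∫ x, e x ∂μ := by
    have : ∫ x, e x * g x ∂μ ≤ ∫ x, ((1 + t) * γ) * e x ∂μ :=
      integral_mono_of_nonneg (ae_of_all _ fun x => mul_nonneg (he0 x) (hg0 x)) (he.const_mul _)
        (ae_of_all _ fun x => by
          show e x * g x ≤ (1 + t) * γ * e x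
          rw [mul_comm ((1 + t) * γ)]; exact mul_le_mul_of_nonneg_left (hbd x).1 (he0 x))
    rwa [integral_const_mul] at this
  -- (3) `γ ∫ e ≤ (1+t) ∫ e g`
  have h3 : γ * ∫ x, e x ∂μ ≤ (1 + t) * ∫ x, e x * g x ∂μ := by
    have : ∫ x, γ * e x ∂μ ≤ ∫ x, (1 + t) * (e x * g x) ∂μ :=
      integral_mono_of_nonneg (ae_of_all _ fun x => mul_nonneg hγ0 (he0 x)) (heg.const_mul _)
        (ae_of_all _ fun x => by
          show γ * e x ≤ (1 + t) * (e x * g x)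
          calc γ * e x ≤ (1 + t) * g x * e x := mul_le_mul_of_nonneg_right (hbd x).2 (he0 x)
            _ = (1 + t) * (e x * g x) := by ring)
    rwa [integral_const_mul, integral_const_mul] at this
  -- (4) hence `|∫ e g − γ ∫ e| ≤ t γ ∫ e`
  have h4 : |(∫ x, e x * g x ∂μ) - γ * ∫ x, e x ∂μ| ≤ t * (γ * ∫ x, e x ∂μ) := by
    have hP : 0 ≤ γ * ∫ x, e x ∂μ := mul_nonneg hγ0 hE0
    rw [abs_le]
    constructor
    · -- lower: `∫eg ≥ γ∫e/(1+t) ≥ γ∫e − t γ∫e`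
      have : γ * ∫ x, e x ∂μ - t * (γ * ∫ x, e x ∂μ) ≤ ∫ x, e x * g x ∂μ := by
        have hegn : 0 ≤ ∫ x, e x * g x ∂μ := integral_nonneg fun x => mul_nonneg (he0 x) (hg0 x)
        nlinarith [h3, hegn, hP, ht]
      linarith
    · nlinarith [h2, hP]
  -- assemble
  have hsplit : (∫ x, I x ∂μ) - (∫ x, e x ∂μ) * γ =
      ((∫ x, I x ∂μ) - ∫ x, e x * g x ∂μ) + ((∫ x, e x * g x ∂μ) - γ * ∫ x, e x ∂μ) := by ring
  rw [hsplit]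
  refine (abs_add_le _ _).trans ?_
  have hegle : ∫ x, e x * g x ∂μ ≤ (1 + t) * ((∫ x, e x ∂μ) * γ) := by nlinarith [h2]
  calc |(∫ x, I x ∂μ) - ∫ x, e x * g x ∂μ| + |(∫ x, e x * g x ∂μ) - γ * ∫ x, e x ∂μ|
      ≤ s * ∫ x, e x * g x ∂μ + t * (γ * ∫ x, e x ∂μ) := add_le_add h1 h4
    _ ≤ s * ((1 + t) * ((∫ x, e x ∂μ) * γ)) + t * ((∫ x, e x ∂μ) * γ) := by
        refine add_le_add (mul_le_mul_of_nonneg_left hegle hs) (le_of_eq (by ring))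
    _ = (s * (1 + t) + t) * ((∫ x, e x ∂μ) * γ) := by ring

end Summit.CriticalPhenomena.CardyFormulaZ2.Theorems.IKLinearTransport.PinnedDiagramExchange.ScreeningAssembly
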